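import Literature.AlgebraicGeometry.HodgeTheory.StablyNondegenerateTypeIIRankTwo
import Literature.AlgebraicGeometry.HodgeTheory.NoTypeIVTimesCMStablyNondegenerate
import Literature.AlgebraicGeometry.HodgeTheory.SymplecticHodgeGroupPowersHodgeClasses
import HarnessLib

/-!
# Abelian varieties with symplectic Hodge Lie algebra (`Hg = Sp`) are stably nondegenerate — unconditional; type I(1) fourfolds in the `Sp` branch times CM factors (Moonen–Zarhin 1999 (1.8), Thm. (0.1)(3); Murty 1984 §3 / Gordon Thm. 7.5)

Family `hodge`, layer `Literature/AlgebraicGeometry/HodgeTheory`. Research context: cell `pub-hodge-ring2` (HONEST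
FRAMING: research route conditional on HC_CM; not a corollary; Q11.4-sentence-2 already refuted in dim ≥ 3), Literature
lane gen 72, programme R49 (the type I(1) row). This file does for the class «`Lie Hg(H¹(A)) ⊗ ℂ` contains every
`ψ_ℂ`-skew operator» (`Hg(A) = Sp(H¹(A;ℚ), ψ)`; for a FOURFOLD with `End⁰ = ℚ`: the `Sp₈` branch of MZ99 Thm. (0.1)(3))
what `StablyNondegenerateTypeIIRankTwo` does for type II of quaternion rank two. THEOREMS ONLY (no definition, no named
fact; D-0026); `HC_CM` occurs only as the binder `hCM` of §2; Hazama 1989 only as the binder `h` of §3. The instance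
hypothesis `[HodgeTensorFacts.{0, 0}]` is the tree's theorem `hodgeTensorFacts_holds`; `hHD`, `hI` are the tree's theorems
`exists_isReal_hodgeModel_holds`, `hodgePQ_independent_of_hodgeModel_holds` (kept as binders, as in
`SymplecticHodgeGroupPowersHodgeClasses`).

* §1 `isStablyNondegenerate_of_hodgeLieC_sp`, `isStablyNondegenerate_powSucc_of_hodgeLieC_sp` — `Hg = Sp` ⟹ every power of
  every power has `B = D` (MZ99 (1.8) «`Hg(X) = Sp_D(V,φ)` ⟺ … `D(Xⁿ) = B(Xⁿ)` for all `n`», direction ⟹; the tree's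
  `AVSlots.isDivisorGenerated_of_hodgeLieC_sp` on the iterated-power slots `exists_avSlots_powSucc_powSucc`) — UNCONDITIONAL,
  every dimension.
* §2 `End⁰(A) = ℚ` and `Hg = Sp` (e.g. the `Sp₈` branch of a type I(1) fourfold), times `C` of CM type:
  `hodgeConjectureFor_powSucc_prod_iff_of_hodgeLieC_sp_of_isOfCMType` — `HC(A^{N+1} × C) ⟺ HC(C)`, UNCONDITIONAL («no type IV»
  × CM, Lombardo 2016 Lemma 3.4 / MZ99 (3.2)); `…_of_cmHodgeHypothesis` (HC_CM as a binder); `…_of_dim_le_three` (UNCONDITIONAL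
  for `dim C ≤ 3`).
* §3 two such varieties, modulo Hazama only: `isStablyNondegenerate_powSucc_prod_powSucc_of_hodgeLieC_sp_of_hazama`,
  `hodgeConjectureFor_powSucc_prod_powSucc_of_hodgeLieC_sp_of_hazama`.

## References

* [MoonenZarhin1999LowDim] B. Moonen, Yu. Zarhin, Math. Ann. 315 (1999), §1 (1.8), Thm. (0.1)(3), §3 Thm. (3.2).
* [MoonenZarhin1995Duke] B. Moonen, Yu. Zarhin, Duke Math. J. 77 (1995), §2 (type I(1)).
* [Murty1984] V. K. Murty, Math. Ann. 268 (1984), §3.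
* [Gordon1999HodgeAVSurvey] B. B. Gordon, A survey of the Hodge conjecture for abelian varieties, Thm. 7.5, Def. 7.6,
  Rem. 7.6.1, Thm. 7.6.2.
* [Lombardo2016] D. Lombardo, Ann. Inst. Fourier 66 (2016), Lemma 3.4 (p. 1229).
* [Hazama1989] F. Hazama, J. Fac. Sci. Univ. Tokyo 31 (1985) 487–520 / Gordon Thm. 7.6.2.
* [Deligne2000] P. Deligne, *The Hodge conjecture* (Clay, 2000), §1.
-/

noncomputable section

open CategoryTheory Module
open scoped TensorProduct

namespace Literature.AlgebraicGeometry.HodgeTheory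

open Literature.AlgebraicGeometry.Motives (AbelianVariety bettiCohomology HodgeTensorFacts)
open Literature.AlgebraicGeometry.ComplexMultiplication
open Literature.AlgebraicGeometry.Milne1999

section SymplecticHodgeGroup

variable [HodgeTensorFacts.{0, 0}] {A : AbelianVariety ℂ}

/-! ### §1 `Hg = Sp` is stably nondegenerate — unconditional, every dimension -/

variable (A) in
/-- **An abelian variety whose complexified Hodge Lie algebra contains every `ψ_ℂ`-skew operator is stably nondegenerate —
UNCONDITIONAL** (MZ99 (1.8) «`Hg(X) = Sp_D(V,φ)` ⟺ … `D(Xⁿ) = B(Xⁿ)` for all `n`», `D = ℚ`, direction ⟹; the tree's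
`hodgeConjectureFor_powSucc_of_hodgeLieC_sp`). [cite: MoonenZarhin1999LowDim, §1 (1.8)]
[cite: Gordon1999HodgeAVSurvey, Thm. 7.5 (1) and Def. 7.6] -/
theorem isStablyNondegenerate_of_hodgeLieC_sp (hHD : exists_isReal_hodgeModel) (hI : hodgePQ_independent_of_hodgeModel)
    (ψ : (BettiUniverse.hodge hHD (AbelianVariety.isSmoothProjective_holds (A := A)) 1).Polarization)
    (hsp : ∀ Y : Module.End ℂ (ℂ ⊗[ℚ] bettiCohomology A.X 1),
      (∀ x y, ψ.form.baseChange ℂ (Y x) y + ψ.form.baseChange ℂ x (Y y) = 0) →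
        Y ∈ (BettiUniverse.hodge hHD (AbelianVariety.isSmoothProjective_holds (A := A)) 1).hodgeLieC) :
    IsStablyNondegenerate A :=
  fun N => (hodgeConjectureFor_powSucc_of_hodgeLieC_sp A hHD hI ψ hsp N).1

variable (A) in
/-- **All powers `A^{M+1}` of such an `A` are stably nondegenerate — UNCONDITIONAL** (the iterated powers have slots over
`A`, `exists_avSlots_powSucc_powSucc`; `AVSlots.isDivisorGenerated_of_hodgeLieC_sp`). [cite: MoonenZarhin1999LowDim, §1 (1.8)]
[cite: Gordon1999HodgeAVSurvey, Rem. 7.6.1] -/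
theorem isStablyNondegenerate_powSucc_of_hodgeLieC_sp (hHD : exists_isReal_hodgeModel)
    (hI : hodgePQ_independent_of_hodgeModel)
    (ψ : (BettiUniverse.hodge hHD (AbelianVariety.isSmoothProjective_holds (A := A)) 1).Polarization)
    (hsp : ∀ Y : Module.End ℂ (ℂ ⊗[ℚ] bettiCohomology A.X 1),
      (∀ x y, ψ.form.baseChange ℂ (Y x) y + ψ.form.baseChange ℂ x (Y y) = 0) →
        Y ∈ (BettiUniverse.hodge hHD (AbelianVariety.isSmoothProjective_holds (A := A)) 1).hodgeLieC) (M : ℕ) :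
    IsStablyNondegenerate (A.powSucc M) := by
  intro N
  obtain ⟨n, g, hg⟩ := exists_avSlots_powSucc_powSucc A M N
  exact hg.isDivisorGenerated_of_hodgeLieC_sp hHD hI ψ hsp

/-! ### §2 `End⁰(A) = ℚ`, `Hg = Sp`, times an abelian variety of CM type («no type IV» × CM; HC_CM only as a binder) -/

/-- **`HC(A^{N+1} × C) ⟺ HC(C)`** for `A` with `finrank_ℚ End⁰(A) = 1` and symplectic Hodge Lie algebra (e.g. a type I(1)
FOURFOLD in the `Sp₈` branch of MZ99 Thm. (0.1)(3)) and `C` of CM type — UNCONDITIONAL («no type IV» × CM, the tree's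
`hodgeConjectureFor_prod_iff_of_hasNoTypeIVFactor_of_isOfCMType`; `End⁰ = ℚ` has no type IV factor,
`hasNoTypeIVFactor_of_finrank_endAlgebra_eq_one`; `HC(A^{N+1})` by §1). [cite: Lombardo2016, Lemma 3.4 (p. 1229)]
[cite: MoonenZarhin1999LowDim, Thm. (0.1)(3) and §3 Thm. (3.2)] -/
theorem hodgeConjectureFor_powSucc_prod_iff_of_hodgeLieC_sp_of_isOfCMType (hHD : exists_isReal_hodgeModel)
    (hI : hodgePQ_independent_of_hodgeModel) (h1 : Module.finrank ℚ A.endAlgebra = 1)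
    (ψ : (BettiUniverse.hodge hHD (AbelianVariety.isSmoothProjective_holds (A := A)) 1).Polarization)
    (hsp : ∀ Y : Module.End ℂ (ℂ ⊗[ℚ] bettiCohomology A.X 1),
      (∀ x y, ψ.form.baseChange ℂ (Y x) y + ψ.form.baseChange ℂ x (Y y) = 0) →
        Y ∈ (BettiUniverse.hodge hHD (AbelianVariety.isSmoothProjective_holds (A := A)) 1).hodgeLieC) (N : ℕ)
    {C : AbelianVariety ℂ} (hCt : Milne1999.IsOfCMType C) :
    HodgeConjectureFor ((A.powSucc N).prod C).dim ((A.powSucc N).prod C).X ↔ HodgeConjectureFor C.dim C.X := by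
  rw [hodgeConjectureFor_prod_iff_of_hasNoTypeIVFactor_of_isOfCMType (A.powSucc N) C
    ((hasNoTypeIVFactor_of_finrank_endAlgebra_eq_one h1).powSucc N) hCt]
  exact ⟨fun h => h.2, fun h => ⟨(hodgeConjectureFor_powSucc_of_hodgeLieC_sp A hHD hI ψ hsp N).2, h⟩⟩

/-- **HC_CM ⟹ HC(`A^{N+1} × C`)** for `A` with `End⁰(A) = ℚ` and symplectic Hodge Lie algebra and `C` of CM type — the
research route's row, CONDITIONAL ON HC_CM (the binder `hCM`, Milne's per-variety form; not a corollary of anything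
unconditional here). [cite: Lombardo2016, Lemma 3.4 (p. 1229)] [cite: MoonenZarhin1999LowDim, §3 Thm. (3.2)] [cite: Deligne2000, §1] -/
theorem hodgeConjectureFor_powSucc_prod_of_hodgeLieC_sp_of_cmHodgeHypothesis
    (hCM : ∀ Y : AbelianVariety ℂ, Milne1999.CMHodgeHypothesisAt Y) (hHD : exists_isReal_hodgeModel)
    (hI : hodgePQ_independent_of_hodgeModel) (h1 : Module.finrank ℚ A.endAlgebra = 1)
    (ψ : (BettiUniverse.hodge hHD (AbelianVariety.isSmoothProjective_holds (A := A)) 1).Polarization)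
    (hsp : ∀ Y : Module.End ℂ (ℂ ⊗[ℚ] bettiCohomology A.X 1),
      (∀ x y, ψ.form.baseChange ℂ (Y x) y + ψ.form.baseChange ℂ x (Y y) = 0) →
        Y ∈ (BettiUniverse.hodge hHD (AbelianVariety.isSmoothProjective_holds (A := A)) 1).hodgeLieC) (N : ℕ)
    {C : AbelianVariety ℂ} (hCt : Milne1999.IsOfCMType C) :
    HodgeConjectureFor ((A.powSucc N).prod C).dim ((A.powSucc N).prod C).X :=
  hodgeConjectureFor_powSucc_prod_of_hasNoTypeIVFactor_of_cmHodgeHypothesis hCM A C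
    (hasNoTypeIVFactor_of_finrank_endAlgebra_eq_one h1) hCt N (hodgeConjectureFor_powSucc_of_hodgeLieC_sp A hHD hI ψ hsp N).2

/-- **UNCONDITIONAL: `HC(A^{N+1} × C)` for `A` with `End⁰(A) = ℚ` and symplectic Hodge Lie algebra and `C` of CM type with
`dim C ≤ 3`** (the equivalence above with the tree's `hodgeConjectureFor_of_dim_le_three_holds`).
[cite: Lombardo2016, Lemma 3.4 (p. 1229)] [cite: MoonenZarhin1999LowDim, Introduction and §3 Thm. (3.2)] -/
theorem hodgeConjectureFor_powSucc_prod_of_hodgeLieC_sp_of_isOfCMType_of_dim_le_three (hHD : exists_isReal_hodgeModel)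
    (hI : hodgePQ_independent_of_hodgeModel) (h1 : Module.finrank ℚ A.endAlgebra = 1)
    (ψ : (BettiUniverse.hodge hHD (AbelianVariety.isSmoothProjective_holds (A := A)) 1).Polarization)
    (hsp : ∀ Y : Module.End ℂ (ℂ ⊗[ℚ] bettiCohomology A.X 1),
      (∀ x y, ψ.form.baseChange ℂ (Y x) y + ψ.form.baseChange ℂ x (Y y) = 0) →
        Y ∈ (BettiUniverse.hodge hHD (AbelianVariety.isSmoothProjective_holds (A := A)) 1).hodgeLieC) (N : ℕ)
    {C : AbelianVariety ℂ} (hCt : Milne1999.IsOfCMType C) (hC3 : C.dim ≤ 3) :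
    HodgeConjectureFor ((A.powSucc N).prod C).dim ((A.powSucc N).prod C).X :=
  (hodgeConjectureFor_powSucc_prod_iff_of_hodgeLieC_sp_of_isOfCMType hHD hI h1 ψ hsp N hCt).2
    (hodgeConjectureFor_of_dim_le_three_holds hC3 Motives.AbelianVariety.isSmoothProjective_holds)

/-! ### §3 Products of two such varieties, modulo Hazama 1989 -/

/-- **Two varieties with `End⁰ = ℚ` and symplectic Hodge Lie algebra, modulo Hazama ONLY**: `A^{M+1} × B^{N+1}` is stably
nondegenerate (both factors unconditionally so, §1, and type-IV-free). [cite: Hazama1989, Thm. (= Gordon 7.6.2)]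
[cite: MoonenZarhin1999LowDim, §1 (1.8)] -/
theorem isStablyNondegenerate_powSucc_prod_powSucc_of_hodgeLieC_sp_of_hazama (h : Hazama1989_stablyNondegenerate_prod)
    (hHD : exists_isReal_hodgeModel) (hI : hodgePQ_independent_of_hodgeModel) (h1 : Module.finrank ℚ A.endAlgebra = 1)
    (ψ : (BettiUniverse.hodge hHD (AbelianVariety.isSmoothProjective_holds (A := A)) 1).Polarization)
    (hsp : ∀ Y : Module.End ℂ (ℂ ⊗[ℚ] bettiCohomology A.X 1),
      (∀ x y, ψ.form.baseChange ℂ (Y x) y + ψ.form.baseChange ℂ x (Y y) = 0) →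
        Y ∈ (BettiUniverse.hodge hHD (AbelianVariety.isSmoothProjective_holds (A := A)) 1).hodgeLieC)
    {B : AbelianVariety ℂ} (h1B : Module.finrank ℚ B.endAlgebra = 1)
    (ψB : (BettiUniverse.hodge hHD (AbelianVariety.isSmoothProjective_holds (A := B)) 1).Polarization)
    (hspB : ∀ Y : Module.End ℂ (ℂ ⊗[ℚ] bettiCohomology B.X 1),
      (∀ x y, ψB.form.baseChange ℂ (Y x) y + ψB.form.baseChange ℂ x (Y y) = 0) →
        Y ∈ (BettiUniverse.hodge hHD (AbelianVariety.isSmoothProjective_holds (A := B)) 1).hodgeLieC)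
    (M N : ℕ) : IsStablyNondegenerate ((A.powSucc M).prod (B.powSucc N)) :=
  (isStablyNondegenerate_powSucc_of_hodgeLieC_sp A hHD hI ψ hsp M).prod_of_hazama h
    (isStablyNondegenerate_powSucc_of_hodgeLieC_sp B hHD hI ψB hspB N)
    ((hasNoTypeIVFactor_of_finrank_endAlgebra_eq_one h1).powSucc M)
    ((hasNoTypeIVFactor_of_finrank_endAlgebra_eq_one h1B).powSucc N)

/-- HC(`A^{M+1} × B^{N+1}`) for two factors with `End⁰ = ℚ` and symplectic Hodge Lie algebra, modulo Hazama only.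
[cite: Hazama1989, Thm. (= Gordon 7.6.2)] [cite: MoonenZarhin1999LowDim, §1 (1.8)] -/
theorem hodgeConjectureFor_powSucc_prod_powSucc_of_hodgeLieC_sp_of_hazama (h : Hazama1989_stablyNondegenerate_prod)
    (hHD : exists_isReal_hodgeModel) (hI : hodgePQ_independent_of_hodgeModel) (h1 : Module.finrank ℚ A.endAlgebra = 1)
    (ψ : (BettiUniverse.hodge hHD (AbelianVariety.isSmoothProjective_holds (A := A)) 1).Polarization)
    (hsp : ∀ Y : Module.End ℂ (ℂ ⊗[ℚ] bettiCohomology A.X 1),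
      (∀ x y, ψ.form.baseChange ℂ (Y x) y + ψ.form.baseChange ℂ x (Y y) = 0) →
        Y ∈ (BettiUniverse.hodge hHD (AbelianVariety.isSmoothProjective_holds (A := A)) 1).hodgeLieC)
    {B : AbelianVariety ℂ} (h1B : Module.finrank ℚ B.endAlgebra = 1)
    (ψB : (BettiUniverse.hodge hHD (AbelianVariety.isSmoothProjective_holds (A := B)) 1).Polarization)
    (hspB : ∀ Y : Module.End ℂ (ℂ ⊗[ℚ] bettiCohomology B.X 1),
      (∀ x y, ψB.form.baseChange ℂ (Y x) y + ψB.form.baseChange ℂ x (Y y) = 0) →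
        Y ∈ (BettiUniverse.hodge hHD (AbelianVariety.isSmoothProjective_holds (A := B)) 1).hodgeLieC)
    (M N : ℕ) : HodgeConjectureFor ((A.powSucc M).prod (B.powSucc N)).dim ((A.powSucc M).prod (B.powSucc N)).X :=
  (isStablyNondegenerate_powSucc_prod_powSucc_of_hodgeLieC_sp_of_hazama h hHD hI h1 ψ hsp h1B ψB hspB M N).hodgeConjectureFor

end SymplecticHodgeGroup

end Literature.AlgebraicGeometry.HodgeTheory

end
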